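import Summits.BirchSwinnertonDyer.BirchSwinnertonDyer.Theses.ErratumRoadFive
import Summits.BirchSwinnertonDyer.BirchSwinnertonDyer.Theorems.ErratumRoadFiveEulerHalfFromUBNotRam
import HarnessLib

/-!
# Route `ErratumRoadFive` (K2, `p ≥ 5`), crux `EulerHalfNotRamNoInertSetAtFive` (item stmt-BirchSwinnertonDyer-19715)
# BY NAME from UB∃♭ᴮ on the ¬(ram) pairs + three binders of the route's `closes` (`PublishedInputsFive`,
# `JSWAnticyclotomicControlMult`, `X11aLowerHalf`)

Cell `bsd-stepL` (run/shared/lean/pub/bsd-stepL/), seat `bsd-stepL-bdp` (prover g19, 2026-08-27).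
`--supports stmt-BirchSwinnertonDyer-19715 --as helper`. The by-name wrapper of
`Theorems/ErratumRoadFiveEulerHalfFromUBNotRam.lean` §4 (which is Theses-free): THIS file imports the route file so that the
conclusion is literally the route decl `…Theses.ErratumRoadFive.EulerHalfNotRamNoInertSetAtFive` and three of the four
hypotheses are literally route decls (items 19066 `PublishedInputsFive`, 19626 `JSWAnticyclotomicControlMult`, 19064
`X11aLowerHalf` — all three ALREADY binders `h₅`, `h331`, `h₃` of `closes`). The fourth hypothesis is the typed input
UB∃♭ᴮ restricted to the ¬(ram) pairs (spelled out; no definition introduced): the Euler-system inclusion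
«`(Q) ⊆ Ch_Λ(X_ac^∅(E/K_∞)_{𝔭bar})·𝓞_{ℂ_p}⟦T⟧`» of the BDP main conjecture for `E` itself at SOME integral frame
`Q` at `(ι', 𝔭_{ι'})` carrying Castella's interpolation property and the value at `𝟙`, for every `𝔭bar ≠ 𝔭_{ι'}` —
H∃♭ᴮ `P2.IMCDivIntFrameOnTreeB` with the last conjunct reversed.

Also: the two REGISTERED stubs of 19715's BC3 skeleton (plan g26 `Lines/birth.lean`: `stub_res_pOnlyMultAtFive` — 334
split-only pairs — and `stub_res_otherMultAtFive` — 70 three-prime pairs), SIGNATURES VERBATIM as conclusions, from the same four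
inputs (`--as helper`: no stub credit is claimed, the road is conditional on UB∃♭ᴮ).

So, AS A ROAD: item 19715 (the 404-pair residual of the Euler-system half after the inert re-key: 334 split-only +
70 three-prime pairs, «only suppliers Kato + Schneider or an 𝓛-invariant road») ⟸ {UB∃♭ᴮ|¬ram, 19066, 19626, 19064} —
no `p`-adic height, no Shimura curve, no Tamagawa condition.

HONEST FRAMING: implication only. UB∃♭ᴮ is OPEN in print at every `p ∣ N` (lit g19 EPS3-SOURCES §E.1); the cell holds
the underlying divisibility at MEMO grade (PROOF-BDP §38.8/§38.10/§39 non-split, §41 split; referee PASS on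
§38/38.8/38.9 only); `X11aLowerHalf` (19064) is an OPEN crux. Item 19715 is NOT closed; nothing is booked or
re-labelled (T7); BSD is proved for no pair.

References: [JetchevSkinnerWan2017] Thm. 3.3.1, §7.4.2 (arXiv:1512.06894 pp. 11, 31); [Castella2018] Thms. 2.3, 3.1,
3.2, §5 (arXiv:1704.06608 pp. 5, 9, 12); [Castella2018Exceptional] Thms. 2.10–2.11; [Skinner2016PacificMC] Thm. C;
[HoffsteinLuo1997]; [Mazur1978] Cor. 4.1; [Miller2011LMS] Def. 1.1.
-/

set_option autoImplicit false
set_option linter.dupNamespace false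

noncomputable section

open scoped Classical NumberField

open WeierstrassCurve NumberField IsDedekindDomain Field PowerSeries
open Literature.NumberTheory.EllipticCurves
open Literature.NumberTheory.EllipticCurves.ModularForms
open Literature.NumberTheory.EllipticCurves.Rank1Residual
open Literature.NumberTheory.EllipticCurves.Rank1Residual.Typed
open Literature.NumberTheory.GaloisRepresentations Literature.NumberTheory.GaloisCohomology
open Literature.NumberTheory.Automorphic
open Summit.BirchSwinnertonDyer.Rank1Residual Summit.BirchSwinnertonDyer.Rank1Residual.X11b
open Summit.BirchSwinnertonDyer.Rank1Residual.X11b.AcSelmer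
open Summit.BirchSwinnertonDyer.BirchSwinnertonDyer.Theses.ErratumRoadFive

namespace Summit.BirchSwinnertonDyer.BirchSwinnertonDyer.Theorems.EulerHalfUB

/-- **Crux 19715 `EulerHalfNotRamNoInertSetAtFive` BY NAME from UB∃♭ᴮ on the ¬(ram) X11b pairs and three `closes`
binders** (`h₅ : PublishedInputsFive` — Gross–Zagier, Kolyvagin, GZK, modularity ×2, Hoffstein–Luo, Mazur 1978 are the
conjuncts used; `h331 : JSWAnticyclotomicControlMult`; `h₃ : X11aLowerHalf`). One line over the Theses-free
`eulerHalfNotRamNoInertSet_body_of_ubB_of_lowerX11a`. CONDITIONAL on UB∃♭ᴮ (memo grade in the cell, open in print) and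
on the open crux `X11aLowerHalf`; item 19715 is NOT closed; nothing booked.
[cite: JetchevSkinnerWan2017, Thm. 3.3.1 and §7.4.2 (arXiv:1512.06894 pp. 11, 31)]
[cite: Castella2018, Thms. 2.3, 3.1, 3.2 (arXiv:1704.06608 pp. 5, 9)] [cite: Miller2011LMS, Def. 1.1] -/
theorem eulerHalfNotRamNoInertSetAtFive_of_ubB_of_items (h₅ : PublishedInputsFive)
    (h331 : JSWAnticyclotomicControlMult) (h₃ : X11aLowerHalf)
    -- UB∃♭ᴮ on the ¬(ram) pairs
    (hUBnr : ∀ (W : WeierstrassCurve ℚ) [W.IsElliptic] [W.IsGloballyMinimal] (p : ℕ) [Fact p.Prime],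
      ¬ Ram W p →
      ∀ (N : ℕ) [NeZero N] (K : Type) [Field K] [NumberField K]
      (Dt : ModularParametrizationData W N) (H : HeegnerDatum N (NumberField.discr K)) (ι : K →+* ℂ)
      (P : (W.baseChange K).toAffine.Point),
      ClassX11b W p → 5 ≤ p → Surj W p → W.conductorNorm ℤ = N → IsImaginaryQuadratic K →
      Odd (NumberField.discr K) → ¬ (p : ℤ) ∣ NumberField.discr K → ¬ p ∣ Units.torsionOrder K →
      SatisfiesHeegnerHypothesis N K →
      (W.quadraticTwist (NumberField.discr K : ℚ)).entireLFunction 1 ≠ 0 →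
      WeierstrassCurve.Affine.Point.map ι.toRatAlgHom P = heegnerPointComplex Dt H →
      ¬ (p : ℤ) ∣ Dt.c → ¬ IsOfFinAddOrder P →
      ∀ (κ : ZpExtension K p), κ.IsAnticyclotomic →
        ∀ (γ : Field.absoluteGaloisGroup K) [Fact (κ.IsTopGenerator γ)]
          (ι' : PadicAlgCl p ≃+* ℂ) (w₀ : InfinitePlace K) (P' : (W.baseChange K).toAffine.Point),
          WeierstrassCurve.Affine.Point.map w₀.embedding.toRatAlgHom P' = heegnerPointComplex Dt H →
          ∀ (e : K →+* ℚ_[p]),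
            (∀ k : 𝓞 K, k ∈ (primeOfEmbeddingDatum p ι' w₀.embedding).asIdeal ↔ ‖e (k : K)‖ < 1) →
            ∃ (ΩK : ℂ) (Ωp : ℂ_[p]) (Q : PowerSeries 𝓞_ℂ_[p]), ΩK ≠ 0 ∧ ‖Ωp‖ = 1 ∧
              R1.IsBDPLFunctionInt p ι' (primeOfEmbeddingDatum p ι' w₀.embedding) κ γ Dt.f ΩK Ωp Q ∧
              R1.BDPValueAtOneIntAt W p e P' Q (W.LFunction p) ∧
              ∀ (𝔭bar : HeightOneSpectrum (𝓞 K)), ((p : ℕ) : 𝓞 K) ∈ 𝔭bar.asIdeal →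
                𝔭bar ≠ primeOfEmbeddingDatum p ι' w₀.embedding →
                Ideal.span {Q} ≤
                  (XAc.charIdeal (W.baseChange K) p κ 𝔭bar ∅ γ).map (PowerSeries.map (R1.toCpInt p))) :
    EulerHalfNotRamNoInertSetAtFive := by
  obtain ⟨hGZ, hKo, -, -, -, hGZK, hmod, hnf, hHL, -, hMaz, -, -, -, -⟩ := h₅
  exact eulerHalfNotRamNoInertSet_body_of_ubB_of_lowerX11a h331 hGZ hKo hGZK hmod hnf hHL hMaz hUBnr h₃

/-! ### The registered stubs of crux 19715's BC3 skeleton (`Cruxes/EulerHalfNotRamNoInertSetAtFive/Lines/birth.lean`, plan g26,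
sha 7d52…∕skeleton of record) — their SIGNATURES VERBATIM as conclusions, from UB∃♭ᴮ|¬ram + the three `closes` binders -/

/-- **Registered stub S1 `stub_res_pOnlyMultAtFive` (the exceptional-zero residual: `p` the ONLY multiplicative prime; 334 pairs) — its
signature VERBATIM — from UB∃♭ᴮ|¬ram + `PublishedInputsFive` + `JSWAnticyclotomicControlMult` + `X11aLowerHalf`.** The stub's own extra binders
(`p ∣ ∏c`, «every multiplicative prime equals p») are not used. `--as helper` (no stub credit is claimed: the road is CONDITIONAL on UB∃♭ᴮ).
[cite: JetchevSkinnerWan2017, Thm. 3.3.1 and §7.4.2 (arXiv:1512.06894 pp. 11, 31)] [cite: Miller2011LMS, Def. 1.1] -/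
theorem stub_res_pOnlyMultAtFive_of_ubB_of_items (h₅ : PublishedInputsFive)
    (h331 : JSWAnticyclotomicControlMult) (h₃ : X11aLowerHalf)
    (hUBnr : ∀ (W : WeierstrassCurve ℚ) [W.IsElliptic] [W.IsGloballyMinimal] (p : ℕ) [Fact p.Prime],
      ¬ Ram W p →
      ∀ (N : ℕ) [NeZero N] (K : Type) [Field K] [NumberField K]
      (Dt : ModularParametrizationData W N) (H : HeegnerDatum N (NumberField.discr K)) (ι : K →+* ℂ)
      (P : (W.baseChange K).toAffine.Point),
      ClassX11b W p → 5 ≤ p → Surj W p → W.conductorNorm ℤ = N → IsImaginaryQuadratic K →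
      Odd (NumberField.discr K) → ¬ (p : ℤ) ∣ NumberField.discr K → ¬ p ∣ Units.torsionOrder K →
      SatisfiesHeegnerHypothesis N K →
      (W.quadraticTwist (NumberField.discr K : ℚ)).entireLFunction 1 ≠ 0 →
      WeierstrassCurve.Affine.Point.map ι.toRatAlgHom P = heegnerPointComplex Dt H →
      ¬ (p : ℤ) ∣ Dt.c → ¬ IsOfFinAddOrder P →
      ∀ (κ : ZpExtension K p), κ.IsAnticyclotomic →
        ∀ (γ : Field.absoluteGaloisGroup K) [Fact (κ.IsTopGenerator γ)]
          (ι' : PadicAlgCl p ≃+* ℂ) (w₀ : InfinitePlace K) (P' : (W.baseChange K).toAffine.Point),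
          WeierstrassCurve.Affine.Point.map w₀.embedding.toRatAlgHom P' = heegnerPointComplex Dt H →
          ∀ (e : K →+* ℚ_[p]),
            (∀ k : 𝓞 K, k ∈ (primeOfEmbeddingDatum p ι' w₀.embedding).asIdeal ↔ ‖e (k : K)‖ < 1) →
            ∃ (ΩK : ℂ) (Ωp : ℂ_[p]) (Q : PowerSeries 𝓞_ℂ_[p]), ΩK ≠ 0 ∧ ‖Ωp‖ = 1 ∧
              R1.IsBDPLFunctionInt p ι' (primeOfEmbeddingDatum p ι' w₀.embedding) κ γ Dt.f ΩK Ωp Q ∧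
              R1.BDPValueAtOneIntAt W p e P' Q (W.LFunction p) ∧
              ∀ (𝔭bar : HeightOneSpectrum (𝓞 K)), ((p : ℕ) : 𝓞 K) ∈ 𝔭bar.asIdeal →
                𝔭bar ≠ primeOfEmbeddingDatum p ι' w₀.embedding →
                Ideal.span {Q} ≤
                  (XAc.charIdeal (W.baseChange K) p κ 𝔭bar ∅ γ).map (PowerSeries.map (R1.toCpInt p))) :
    ∀ (W : WeierstrassCurve ℚ) [W.IsElliptic] [W.IsGloballyMinimal] (p : ℕ) [Fact p.Prime],
      Summit.BirchSwinnertonDyer.Rank1Residual.ClassX11b W p → 5 ≤ p →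
      Literature.NumberTheory.EllipticCurves.Rank1Residual.Surj W p →
      ¬ Literature.NumberTheory.EllipticCurves.Rank1Residual.Ram W p → p ∣ W.tamagawaProduct →
      (∀ (ℓ : ℕ) [Fact ℓ.Prime], W.HasMultiplicativeReductionAtPrime ℓ → ℓ = p) →
      Literature.NumberTheory.EllipticCurves.Rank1Residual.Typed.MissingUpperBoundAt W p := by
  obtain ⟨hGZ, hKo, -, -, -, hGZK, hmod, hnf, hHL, -, hMaz, -, -, -, -⟩ := h₅
  intro W _ _ p _ hX hp5 hsurj hnram _ _
  exact missingUpperBoundAt_of_classX11b_of_not_ram_of_ubB_of_lowerX11a h331 hGZ hKo hGZK hmod hnf hHL hMaz W p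
    hX hp5 hsurj hnram (hUBnr W p hnram) (fun Wd _ _ hXa ↦ h₃ Wd p hXa)

/-- **Registered stub S2 `stub_res_otherMultAtFive` (the parity∕congruence-obstructed residual: a multiplicative `ℓ ≠ p`, no inert-set datum; 70
pairs) — its signature VERBATIM — from the same four inputs.** The stub's extra binders are not used. `--as helper`.
[cite: JetchevSkinnerWan2017, Thm. 3.3.1 and §7.4.2 (arXiv:1512.06894 pp. 11, 31)] [cite: Miller2011LMS, Def. 1.1] -/
theorem stub_res_otherMultAtFive_of_ubB_of_items (h₅ : PublishedInputsFive)
    (h331 : JSWAnticyclotomicControlMult) (h₃ : X11aLowerHalf)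
    (hUBnr : ∀ (W : WeierstrassCurve ℚ) [W.IsElliptic] [W.IsGloballyMinimal] (p : ℕ) [Fact p.Prime],
      ¬ Ram W p →
      ∀ (N : ℕ) [NeZero N] (K : Type) [Field K] [NumberField K]
      (Dt : ModularParametrizationData W N) (H : HeegnerDatum N (NumberField.discr K)) (ι : K →+* ℂ)
      (P : (W.baseChange K).toAffine.Point),
      ClassX11b W p → 5 ≤ p → Surj W p → W.conductorNorm ℤ = N → IsImaginaryQuadratic K →
      Odd (NumberField.discr K) → ¬ (p : ℤ) ∣ NumberField.discr K → ¬ p ∣ Units.torsionOrder K →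
      SatisfiesHeegnerHypothesis N K →
      (W.quadraticTwist (NumberField.discr K : ℚ)).entireLFunction 1 ≠ 0 →
      WeierstrassCurve.Affine.Point.map ι.toRatAlgHom P = heegnerPointComplex Dt H →
      ¬ (p : ℤ) ∣ Dt.c → ¬ IsOfFinAddOrder P →
      ∀ (κ : ZpExtension K p), κ.IsAnticyclotomic →
        ∀ (γ : Field.absoluteGaloisGroup K) [Fact (κ.IsTopGenerator γ)]
          (ι' : PadicAlgCl p ≃+* ℂ) (w₀ : InfinitePlace K) (P' : (W.baseChange K).toAffine.Point),
          WeierstrassCurve.Affine.Point.map w₀.embedding.toRatAlgHom P' = heegnerPointComplex Dt H →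
          ∀ (e : K →+* ℚ_[p]),
            (∀ k : 𝓞 K, k ∈ (primeOfEmbeddingDatum p ι' w₀.embedding).asIdeal ↔ ‖e (k : K)‖ < 1) →
            ∃ (ΩK : ℂ) (Ωp : ℂ_[p]) (Q : PowerSeries 𝓞_ℂ_[p]), ΩK ≠ 0 ∧ ‖Ωp‖ = 1 ∧
              R1.IsBDPLFunctionInt p ι' (primeOfEmbeddingDatum p ι' w₀.embedding) κ γ Dt.f ΩK Ωp Q ∧
              R1.BDPValueAtOneIntAt W p e P' Q (W.LFunction p) ∧
              ∀ (𝔭bar : HeightOneSpectrum (𝓞 K)), ((p : ℕ) : 𝓞 K) ∈ 𝔭bar.asIdeal →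
                𝔭bar ≠ primeOfEmbeddingDatum p ι' w₀.embedding →
                Ideal.span {Q} ≤
                  (XAc.charIdeal (W.baseChange K) p κ 𝔭bar ∅ γ).map (PowerSeries.map (R1.toCpInt p))) :
    ∀ (W : WeierstrassCurve ℚ) [W.IsElliptic] [W.IsGloballyMinimal] (p : ℕ) [Fact p.Prime],
      Summit.BirchSwinnertonDyer.Rank1Residual.ClassX11b W p → 5 ≤ p →
      Literature.NumberTheory.EllipticCurves.Rank1Residual.Surj W p →
      ¬ Literature.NumberTheory.EllipticCurves.Rank1Residual.Ram W p → p ∣ W.tamagawaProduct →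
      (∃ ℓ : ℕ, ∃ _ : Fact ℓ.Prime, ℓ ≠ p ∧ W.HasMultiplicativeReductionAtPrime ℓ) →
      ¬ (∃ S : Finset ℕ, (∀ ℓ ∈ S, ∃ _ : Fact ℓ.Prime, Literature.NumberTheory.EllipticCurves.Rank1Residual.Mult W ℓ) ∧
          Even S.card ∧ p ∈ S ∧
          (∀ (ℓ : ℕ) [Fact ℓ.Prime], ℓ ∉ S → W.HasSplitMultiplicativeReductionAtPrime ℓ →
            ¬ p ∣ padicValInt ℓ W.minimalDiscriminantInt) ∧
          (¬ p ∣ padicValInt p W.minimalDiscriminantInt ∨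
            ∃ R ⊆ S, S.card = 2 * R.card ∧ ∀ q ∈ R, q ≠ 2 ∧ ¬ p ∣ q - 1)) →
      Literature.NumberTheory.EllipticCurves.Rank1Residual.Typed.MissingUpperBoundAt W p := by
  obtain ⟨hGZ, hKo, -, -, -, hGZK, hmod, hnf, hHL, -, hMaz, -, -, -, -⟩ := h₅
  intro W _ _ p _ hX hp5 hsurj hnram _ _ _
  exact missingUpperBoundAt_of_classX11b_of_not_ram_of_ubB_of_lowerX11a h331 hGZ hKo hGZK hmod hnf hHL hMaz W p
    hX hp5 hsurj hnram (hUBnr W p hnram) (fun Wd _ _ hXa ↦ h₃ Wd p hXa)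

end Summit.BirchSwinnertonDyer.BirchSwinnertonDyer.Theorems.EulerHalfUB

end
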